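import Summits.KontsevichZagierPeriods.KontsevichZagierPeriods.Theorems.RealOnePeriodRelations.Negative.Kit
import Literature.NumberTheory.Transcendental.KZCalculusProofs
import Literature.NumberTheory.Transcendental.CurvePeriods

/-!
# `RealOnePeriodRelations` (stmt-KontsevichZagierPeriods-10042), line `nash-retraction-thin-strip`:
# stub `stub_arcSymbols`, auxiliary file 1 — assembly of the normalisation from standard pieces

Book-keeping half of the normalisation `Ψ` of one 1-dimensional Kontsevich–Zagier representation
`r`: suppose `r` has been reduced, modulo `closure (1a ∪ 2)`, to finitely many representations
`R j = [∫_{(0,1)} g_j]` (`j : Fin k`), and every `g_j` is the period integrand of a period symbol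
`S j` of curve type along a `ℚ`-semialgebraic path (`(S j).period = ∫₀¹ g_j` and `R j` realises
`S j` with coefficient `1`). Then `C = Σ_j 𝟙_{S j}` (natural-number coefficients, multiplicities
allowed) together with, for every symbol `s` in its support, the representation
`[∫_{(0,1)} (#{j | S j = s}) · g_{j₀}]` is a normalisation of `r`: algebraic coefficients,
semialgebraic paths, realisations, `evalCombination C = value r` (soundness of the moves 1a and 2,
`KZ.relations_le_ker_eval_holds`), and `[r] − Σ_s [R' s] ∈ M₁` (multiplicities are rule 1b).
Everything here is elementary bookkeeping in the free abelian group of representations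
[Kontsevich–Zagier 2001, §1.2]; the analytic input (Puiseux flattening, étale shift, section
symbols) lives in the other files of the stub.

References: M. Kontsevich, D. Zagier, *Periods* (2001), §1.2; A. Huber, G. Wüstholz,
*Transcendence and Linear Relations of 1-Periods* (2022), Prop. 12.5, §3.3.1.
-/

noncomputable section

open scoped BigOperators
open Set MeasureTheory
open Literature.NumberTheory.Transcendental Literature.NumberTheory.Transcendental.CurvePeriods
open Literature.ModelTheory.ExponentialFields (IsSemialgebraic)
open Summit.KontsevichZagierPeriods.SymplecticScissors.RealOnePeriodRelationsNegative (M₁ unitDom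
  setIntegral_unitDom)

namespace Summit.KontsevichZagierPeriods.SymplecticScissors.RealOnePeriodRelations

namespace ArcSymbols

/-! ## Moves modulo `M₁` -/

/-- A representation whose integrand vanishes on its domain lies in `M₁` (rule 1b with
`r = r₁ = r₂` gives `−[r]`). [cite: KontsevichZagier2001, §1.2] -/
theorem of_mem_M₁_of_integrand_zero (r : KZ.IntegralRep 1) (h : ∀ z ∈ r.domain, r.integrand z = 0) :
    KZ.of r ∈ M₁ := by
  have hmem : KZ.of r - KZ.of r - KZ.of r ∈ KZ.integrandAddRel :=
    ⟨1, r, r, r, rfl, rfl, fun z hz => by simp [Pi.add_apply, h z hz], rfl⟩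
  have h1 : KZ.of r - KZ.of r - KZ.of r ∈ M₁ :=
    AddSubgroup.subset_closure (Or.inl (Or.inl (Or.inr hmem)))
  have h2 : KZ.of r - KZ.of r - KZ.of r = -KZ.of r := by abel
  rw [h2] at h1
  exact neg_mem_iff.mp h1

/-- Rule 1b: additivity of the integrand on a common domain, as membership in `M₁`.
[cite: KontsevichZagier2001, §1.2] -/
theorem sub_sub_mem_M₁_of_add (r r₁ r₂ : KZ.IntegralRep 1) (h₁ : r₁.domain = r.domain)
    (h₂ : r₂.domain = r.domain)
    (h : ∀ z ∈ r.domain, r.integrand z = r₁.integrand z + r₂.integrand z) :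
    KZ.of r - KZ.of r₁ - KZ.of r₂ ∈ M₁ :=
  AddSubgroup.subset_closure (Or.inl (Or.inl (Or.inr ⟨1, r, r₁, r₂, h₁, h₂, fun z hz => h z hz, rfl⟩)))

/-- `closure (1a ∪ 2) ≤ M₁`. [cite: KontsevichZagier2001, §1.2] -/
theorem closure_dom_cov_le_M₁ :
    AddSubgroup.closure (KZ.domainAddRel ∪ KZ.changeOfVariablesRel) ≤ M₁ := by
  refine AddSubgroup.closure_mono ?_
  rintro x (h | h)
  · exact Or.inl (Or.inl (Or.inl h))
  · exact Or.inl (Or.inr h)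

/-- Evaluation vanishes on `closure (1a ∪ 2)` (soundness of the moves,
`KZ.relations_le_ker_eval_holds`). [cite: KontsevichZagier2001, §1.2] -/
theorem eval_eq_zero_of_mem_closure_dom_cov {c : KZ.FormalRep}
    (hc : c ∈ AddSubgroup.closure (KZ.domainAddRel ∪ KZ.changeOfVariablesRel)) : KZ.eval c = 0 := by
  have hle : AddSubgroup.closure (KZ.domainAddRel ∪ KZ.changeOfVariablesRel) ≤ KZ.relations := by
    refine AddSubgroup.closure_mono ?_
    rintro x (h | h)
    · exact Or.inl (Or.inl (Or.inl h))
    · exact Or.inl (Or.inr h)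
  exact KZ.relations_le_ker_eval_holds (hle hc)

/-- Natural multiples of a representation: same domain, integrand `n · f` (semialgebraic and
integrable with `f`). [folklore] -/
theorem exists_natMul (n : ℕ) (r : KZ.IntegralRep 1) :
    ∃ r' : KZ.IntegralRep 1, r'.domain = r.domain ∧ ∀ z, r'.integrand z = (n : ℝ) * r.integrand z :=
  ⟨⟨r.domain, fun z => (n : ℝ) * r.integrand z, r.isSemialgebraic_domain,
    IsSemialgebraicFunOn.mul_holds (isSemialgebraicFunOn_natCast r.isSemialgebraic_domain n)
      r.isSemialgebraicFunOn_integrand, r.integrableOn.const_mul _⟩, rfl, fun _ => rfl⟩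

/-- MULTIPLICITIES BY RULE 1b: finitely many representations on a common domain `D` whose
integrands agree with `f` on `D`, minus one representation on `D` with integrand `(#t) · f`, lies
in `M₁` (induction on `t`: `(#t + 1) f = f + (#t) f` is rule 1b, `[∫ 0] ∈ M₁`).
[cite: KontsevichZagier2001, §1.2] -/
theorem sum_sub_mem_M₁_of_card_mul {ι : Type*} (D : Set (Fin 1 → ℝ)) (f : (Fin 1 → ℝ) → ℝ)
    (R : ι → KZ.IntegralRep 1) (t : Finset ι) (hdom : ∀ j ∈ t, (R j).domain = D)
    (hint : ∀ j ∈ t, ∀ z ∈ D, (R j).integrand z = f z) (r' : KZ.IntegralRep 1)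
    (hr'dom : r'.domain = D) (hr'int : ∀ z ∈ D, r'.integrand z = (t.card : ℝ) * f z) :
    ∑ j ∈ t, KZ.of (R j) - KZ.of r' ∈ M₁ := by
  classical
  induction t using Finset.induction_on generalizing r' with
  | empty =>
    rw [Finset.sum_empty, zero_sub]
    refine neg_mem (of_mem_M₁_of_integrand_zero r' fun z hz => ?_)
    rw [hr'dom] at hz
    simpa using hr'int z hz
  | insert a t ha ih =>
    have hdomA : (R a).domain = D := hdom a (Finset.mem_insert_self a t)
    obtain ⟨r'', hr''dom, hr''int⟩ := exists_natMul t.card (R a)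
    have h1 : ∑ j ∈ t, KZ.of (R j) - KZ.of r'' ∈ M₁ :=
      ih (fun j hj => hdom j (Finset.mem_insert_of_mem hj))
        (fun j hj => hint j (Finset.mem_insert_of_mem hj)) r'' (hr''dom.trans hdomA) fun z hz => by
          rw [hr''int, hint a (Finset.mem_insert_self a t) z hz]
    have h2 : KZ.of r' - KZ.of (R a) - KZ.of r'' ∈ M₁ := by
      refine sub_sub_mem_M₁_of_add r' (R a) r'' (hdomA.trans hr'dom.symm)
        ((hr''dom.trans hdomA).trans hr'dom.symm) fun z hz => ?_
      rw [hr'dom] at hz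
      rw [hr'int z hz, hr''int, hint a (Finset.mem_insert_self a t) z hz,
        Finset.card_insert_of_notMem ha]
      push_cast
      ring
    have h3 : ∑ j ∈ insert a t, KZ.of (R j) - KZ.of r' =
        (∑ j ∈ t, KZ.of (R j) - KZ.of r'') - (KZ.of r' - KZ.of (R a) - KZ.of r'') := by
      rw [Finset.sum_insert ha]; abel
    rw [h3]
    exact sub_mem h1 h2

/-! ## Evaluation bookkeeping -/

/-- `evalCombination` of a finite sum of combinations. [folklore] -/
theorem evalCombination_finset_sum {ι : Type*} (t : Finset ι) (c : ι → PeriodSymbol →₀ ℂ) :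
    evalCombination (∑ j ∈ t, c j) = ∑ j ∈ t, evalCombination (c j) := by
  classical
  induction t using Finset.induction_on with
  | empty => simp [evalCombination]
  | insert a t ha ih => rw [Finset.sum_insert ha, Finset.sum_insert ha, evalCombination_add, ih]

/-- The value of a representation on the unit interval whose integrand is `g (z 0)` there is
`∫₀¹ g`. [folklore] -/
theorem value_eq_intervalIntegral (r : KZ.IntegralRep 1) (g : ℝ → ℝ)
    (hdom : r.domain = {z | z 0 ∈ Set.Ioo (0 : ℝ) 1}) (hint : ∀ z ∈ r.domain, r.integrand z = g (z 0)) :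
    r.value = ∫ t in (0 : ℝ)..1, g t := by
  unfold KZ.IntegralRep.value
  rw [← setIntegral_unitDom]
  rw [hdom] at hint ⊢
  exact setIntegral_congr_fun (measurableSet_Ioo.preimage (measurable_pi_apply 0)) fun z hz => hint z hz

/-! ## Assembly -/

/-- **ASSEMBLY OF THE NORMALISATION OF ONE REPRESENTATION.** If `[r] − Σ_j [R j] ∈ closure (1a ∪ 2)`
with `R j = [∫_{(0,1)} g_j]`, and every `g_j` is realised with coefficient `1` by a period symbol
`S j` of curve type along a `ℚ`-semialgebraic path with `(S j).period = ∫₀¹ g_j`, then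
`C = Σ_j 𝟙_{S j}` and the multiplicity representations `R'` normalise `r`: algebraic (natural)
coefficients, semialgebraic paths, realisations `[∫ Re(C_s · ω(γ)γ′)] = [∫ #{j | S j = s}·g_{j₀}]`,
`evalCombination C = value r`, and `[r] − Σ_{s ∈ supp C} [R' s] ∈ M₁`.
[cite: HuberWustholz2022, Prop. 12.5] -/
theorem assemble (r : KZ.IntegralRep 1) {k : ℕ} (g : Fin k → ℝ → ℝ) (R : Fin k → KZ.IntegralRep 1)
    (S : Fin k → PeriodSymbol)
    (hSA : ∀ j, IsSemialgebraicMapOn ℚ {z : Fin 1 → ℝ | z 0 ∈ Set.Icc (0 : ℝ) 1}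
      (fun z => Fin.append (fun i => ((S j).γ.toFun (z 0) i).re) (fun i => ((S j).γ.toFun (z 0) i).im)))
    (hper : ∀ j, (S j).period = ((∫ s in (0 : ℝ)..1, g j s : ℝ) : ℂ))
    (hR : ∀ j, (R j).domain = {z | z 0 ∈ Set.Ioo (0 : ℝ) 1} ∧
      ∀ z ∈ (R j).domain, (R j).integrand z = g j (z 0))
    (hreal : ∀ j, ∀ z ∈ (R j).domain, (R j).integrand z =
      ((1 : ℂ) * ∑ i, MvPolynomial.eval ((S j).γ.toFun (z 0)) ((S j).ω i) *
        deriv (fun t => (S j).γ.toFun t i) (z 0)).re)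
    (hrel : KZ.of r - ∑ j, KZ.of (R j) ∈ AddSubgroup.closure (KZ.domainAddRel ∪ KZ.changeOfVariablesRel)) :
    ∃ (C : PeriodSymbol →₀ ℂ) (R' : PeriodSymbol → KZ.IntegralRep 1), (∀ s, IsAlgebraic ℚ (C s)) ∧
      (∀ s ∈ C.support, IsSemialgebraicMapOn ℚ {z : Fin 1 → ℝ | z 0 ∈ Set.Icc (0 : ℝ) 1}
        (fun z => Fin.append (fun i => (s.γ.toFun (z 0) i).re) (fun i => (s.γ.toFun (z 0) i).im))) ∧
      (∀ s ∈ C.support, (R' s).domain = {z | z 0 ∈ Set.Ioo (0 : ℝ) 1} ∧ ∀ z ∈ (R' s).domain,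
        (R' s).integrand z = (C s * ∑ i, MvPolynomial.eval (s.γ.toFun (z 0)) (s.ω i) *
          deriv (fun u => s.γ.toFun u i) (z 0)).re) ∧
      evalCombination C = ((r.value : ℝ) : ℂ) ∧ KZ.of r - ∑ s ∈ C.support, KZ.of (R' s) ∈ M₁ := by
  classical
  -- multiplicities
  set n : PeriodSymbol → ℕ := fun s => (Finset.univ.filter fun j => S j = s).card with hn
  set C : PeriodSymbol →₀ ℂ := ∑ j, Finsupp.single (S j) (1 : ℂ) with hC
  have hCs : ∀ s, C s = (n s : ℂ) := fun s => by
    rw [hC, Finsupp.finsetSum_apply]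
    simp only [Finsupp.single_apply]
    rw [Finset.sum_boole]
  have hsupp : C.support = Finset.image S Finset.univ := by
    ext s
    rw [Finsupp.mem_support_iff, hCs, Nat.cast_ne_zero, hn, Finset.mem_image]
    simp only
    rw [Finset.card_ne_zero, Finset.filter_nonempty_iff]
  have hex : ∀ s ∈ C.support, ∃ j, S j = s := fun s hs => by
    rw [hsupp, Finset.mem_image] at hs
    obtain ⟨j, -, hj⟩ := hs
    exact ⟨j, hj⟩
  -- the realising representations, with multiplicity
  set R' : PeriodSymbol → KZ.IntegralRep 1 := fun s =>
    if h : ∃ j, S j = s then (exists_natMul (n s) (R h.choose)).choose else r with hR'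
  have hR'spec : ∀ s (h : ∃ j, S j = s), (R' s).domain = (R h.choose).domain ∧
      ∀ z, (R' s).integrand z = (n s : ℝ) * (R h.choose).integrand z := fun s h => by
    have e : R' s = (exists_natMul (n s) (R h.choose)).choose := by rw [hR']; exact dif_pos h
    rw [e]
    exact (exists_natMul (n s) (R h.choose)).choose_spec
  refine ⟨C, R', fun s => ?_, fun s hs => ?_, fun s hs => ?_, ?_, ?_⟩
  · rw [hCs]; exact isAlgebraic_nat _
  · obtain ⟨j, rfl⟩ := hex s hs
    exact hSA j
  · have h := hex s hs
    obtain ⟨hdom', hint'⟩ := hR'spec s h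
    have key : ∀ j, S j = s → (R' s).domain = (R j).domain →
        (∀ z, (R' s).integrand z = (n s : ℝ) * (R j).integrand z) →
        ((R' s).domain = {z | z 0 ∈ Set.Ioo (0 : ℝ) 1} ∧
          ∀ z ∈ (R' s).domain, (R' s).integrand z =
            (C s * ∑ i, MvPolynomial.eval (s.γ.toFun (z 0)) (s.ω i) *
              deriv (fun u => s.γ.toFun u i) (z 0)).re) := by
      rintro j rfl hd hi
      refine ⟨hd.trans (hR j).1, fun z hz => ?_⟩
      rw [hd] at hz
      rw [hi, hreal j z hz, hCs, one_mul, ← Complex.ofReal_natCast, Complex.re_ofReal_mul]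
    exact key h.choose h.choose_spec hdom' hint'
  · -- evaluation
    have h1 : evalCombination C = ∑ j, ((∫ s in (0 : ℝ)..1, g j s : ℝ) : ℂ) := by
      rw [hC, evalCombination_finset_sum]
      refine Finset.sum_congr rfl fun j _ => ?_
      rw [evalCombination_single, one_mul, hper j]
    have h2 : r.value = ∑ j, (R j).value := by
      have h := eval_eq_zero_of_mem_closure_dom_cov hrel
      rw [map_sub, map_sum, sub_eq_zero, KZ.eval_of] at h
      rw [h]
      exact Finset.sum_congr rfl fun j _ => KZ.eval_of _
    rw [h1, h2, Complex.ofReal_sum]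
    exact Finset.sum_congr rfl fun j _ => by
      rw [value_eq_intervalIntegral (R j) (g j) (hR j).1 (hR j).2]
  · -- moves
    have h1 : KZ.of r - ∑ j, KZ.of (R j) ∈ M₁ := closure_dom_cov_le_M₁ hrel
    have h2 : ∑ j, KZ.of (R j) - ∑ s ∈ C.support, KZ.of (R' s) ∈ M₁ := by
      rw [hsupp, ← Finset.sum_fiberwise_of_maps_to (g := S) (t := Finset.image S Finset.univ)
        (s := Finset.univ) (f := fun j => KZ.of (R j)) fun j hj => Finset.mem_image_of_mem S hj,
        ← Finset.sum_sub_distrib]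
      refine sum_mem fun s hs => ?_
      have h : ∃ j, S j = s := by
        obtain ⟨j, -, hj⟩ := Finset.mem_image.1 hs
        exact ⟨j, hj⟩
      obtain ⟨hdom', hint'⟩ := hR'spec s h
      set j₀ := h.choose with hj₀
      have hj₀S : S j₀ = s := h.choose_spec
      refine sum_sub_mem_M₁_of_card_mul {z | z 0 ∈ Set.Ioo (0 : ℝ) 1} (fun z => g j₀ (z 0)) R _
        (fun j _ => (hR j).1) (fun j hj z hz => ?_) _ (hdom'.trans (hR j₀).1) (fun z hz => ?_)
      · have hjS : S j = s := (Finset.mem_filter.1 hj).2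
        have hzj : z ∈ (R j).domain := by rw [(hR j).1]; exact hz
        have hzj₀ : z ∈ (R j₀).domain := by rw [(hR j₀).1]; exact hz
        rw [← (hR j₀).2 z hzj₀, hreal j z hzj, hreal j₀ z hzj₀, hjS, hj₀S]
      · have hzj₀ : z ∈ (R j₀).domain := by rw [(hR j₀).1]; exact hz
        rw [hint', (hR j₀).2 z hzj₀]
    have h3 : KZ.of r - ∑ s ∈ C.support, KZ.of (R' s) =
        (KZ.of r - ∑ j, KZ.of (R j)) + (∑ j, KZ.of (R j) - ∑ s ∈ C.support, KZ.of (R' s)) := by abel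
    rw [h3]
    exact add_mem h1 h2

end ArcSymbols

/-- **Registered anchor `helper_arcSymbols_1`** (rule 1b as membership in `M₁`: additivity of the
integrand on a common domain). [cite: KontsevichZagier2001, §1.2] -/
theorem helper_arcSymbols_1 : ∀ (r r₁ r₂ : KZ.IntegralRep 1), r₁.domain = r.domain → r₂.domain = r.domain → (∀ z ∈ r.domain, r.integrand z = r₁.integrand z + r₂.integrand z) → KZ.of r - KZ.of r₁ - KZ.of r₂ ∈ M₁ :=
  ArcSymbols.sub_sub_mem_M₁_of_add

end Summit.KontsevichZagierPeriods.SymplecticScissors.RealOnePeriodRelations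

end
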